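import Literature.NumberTheory.ConnesConsani2023.ZetaCyclesProofs
import Literature.NumberTheory.ConnesConsani2023.ZetaCyclesRotations
import HarnessLib

/-!
# ζ-cycles: Corollary 6.5 and Proposition 6.3 of Connes–Consani 2023

RH-FREE corpus literature (Connes–Consani 2023, *Spectral triples and ζ-cycles*, §6; cell rh-crit C1,
row t11).  Sequel of `ZetaCyclesProofs.lean` (Theorem 6.4) and `ZetaCyclesRotations.lean` (Lemma 6.2 (ii),
Peter–Weyl on the circle).  Everything here is PROVED; no new named facts.  This file DISCHARGES
`CC2023_cor_6_5` and `CC2023_prop_6_3` of `ZetaCycles.lean`.  Nothing in this file bears on the truth of RH.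

* **Corollary 6.5**: `𝓗(L) ≠ {0} ↔ ∃ s ∈ Z, n ∈ ℤ, sL = 2πn` (`→`: a nonzero closed rotation-invariant
  subspace contains a character `e_n`, and `e_n ∈ 𝓗(L)` forces `ζ(½ + 2πi n/L) = 0` by Theorem 6.4 (i);
  `←`: Theorem 6.4 (ii), after replacing `s` by `−s` if necessary);
* **Proposition 6.3** (finite covers of ζ-cycles are ζ-cycles), deduced from Corollary 6.5 (shorter than
  the printed pull-back argument: `sL = 2πk ⇒ s(nL) = 2π(nk)`).

## References

* A. Connes, C. Consani, *Spectral triples and ζ-cycles*, Enseign. Math. 69 (2023) 93–148,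
  arXiv:2106.01715, §6, Proposition 6.3, Theorem 6.4, Corollary 6.5 [ConnesConsani2023].
-/

noncomputable section

open scoped Topology SchwartzMap ENNReal ComplexConjugate
open Function Filter MeasureTheory Complex Set AddCircle
open Literature.NumberTheory.LFunctions

namespace Literature.NumberTheory.ConnesConsani2023.ZetaCycles

/-! ### Corollary 6.5 -/

/-- **Corollary 6.5** (discharge of `CC2023_cor_6_5`): `𝓗(L) ≠ {0} ↔ ∃ s ∈ Z, n ∈ ℤ, sL = 2πn`, where `Z`
is the set of imaginary parts of the zeros of `ζ` on the critical line.  RH-FREE; nothing here bears on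
the truth of RH. [cite: ConnesConsani2023, Corollary 6.5 (arXiv chunk p0020:L5–L12)] -/
theorem CC2023_cor_6_5_holds : CC2023_cor_6_5 := by
  intro L hL
  constructor
  · intro hne
    obtain ⟨n, hn⟩ := exists_fourierLp_mem_zetaCycleSpace hne
    have hsL : 2 * Real.pi * n / L * L = 2 * Real.pi * n := div_mul_cancel₀ _ hL.out.ne'
    exact ⟨2 * Real.pi * n / L, CC2023_thm_6_4_i_holds L _ ⟨n, hsL, hn⟩, n, hsL⟩
  · rintro ⟨s, hzeta, n, hsL⟩ hbot
    have hmem := fourierLp_mem_zetaCycleSpace (L := L) hsL hzeta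
    rw [hbot, Submodule.mem_bot] at hmem
    have h1 : ‖(fourierLp 2 n : Lp ℂ 2 (@haarAddCircle L hL))‖ = 1 := orthonormal_fourier.1 n
    rw [hmem, norm_zero] at h1
    exact zero_ne_one h1

/-! ### Proposition 6.3: stability under finite covers -/

/-- **Proposition 6.3** (discharge of `CC2023_prop_6_3`): the `n`-fold cover (length `nL`) of a ζ-cycle
of length `L` is a ζ-cycle.  The printed proof pulls an orthogonal vector back along the cover
(p0019:L11–L12); here the shorter road through Corollary 6.5 is taken: `𝓗(L) ≠ 0` gives `s ∈ Z`,
`k ∈ ℤ` with `sL = 2πk`, hence `s(nL) = 2π(nk)` and `𝓗(nL) ≠ 0`.  RH-FREE.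
[cite: ConnesConsani2023, Proposition 6.3 (arXiv chunk p0019:L9–L12)] -/
theorem CC2023_prop_6_3_holds : CC2023_prop_6_3 := by
  intro L L' hL hL' n _hn hL'L hcyc
  rw [isZetaCycle_iff_zetaCycleSpace_ne_bot] at hcyc ⊢
  obtain ⟨s, hzeta, k, hsL⟩ := (CC2023_cor_6_5_holds L).1 hcyc
  refine (CC2023_cor_6_5_holds L').2 ⟨s, hzeta, n * k, ?_⟩
  rw [hL'L]
  push_cast
  calc s * ((n : ℝ) * L) = (n : ℝ) * (s * L) := by ring
    _ = 2 * Real.pi * ((n : ℝ) * k) := by rw [hsL]; ring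

/-- Definition 6.1 and Corollary 6.5 combined: the circle of length `L` is a ζ-cycle iff `sL ∈ 2πℤ` for
some imaginary part `s` of a zero of `ζ` on the critical line.  RH-FREE.
[cite: ConnesConsani2023, Definition 6.1 and Corollary 6.5 (arXiv chunks p0019:L5, p0020:L5–L12)] -/
theorem isZetaCycle_iff_exists_zeta_zero (L : ℝ) [Fact (0 < L)] :
    IsZetaCycle L ↔ ∃ s : ℝ, riemannZeta (1 / 2 + s * I) = 0 ∧ ∃ n : ℤ, s * L = 2 * Real.pi * n := by
  rw [isZetaCycle_iff_zetaCycleSpace_ne_bot]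
  exact CC2023_cor_6_5_holds L

end Literature.NumberTheory.ConnesConsani2023.ZetaCycles
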